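import Summits.CriticalPhenomena.Ising3D.Control2DVertexChiral
import Mathlib.Analysis.SpecialFunctions.Exponential
import Mathlib.Tactic
import HarnessLib

/-!
# The free-boson vertex-operator witness, IV: `(1-x)^{∓q} - 1 = Σ_n (±1)^n α_n(q) k_{2n}(x)` and
`x^{2q}/(1-x)^q = Σ_k γ_k(q) k_{4q+4k}(x)` as `HasSum` identities
(cell `pub-ising3x`, seat controls-1 gen 36; NON-VACUITY of the 2D control's hypothesis classes WITH a
stress tensor, step 4 of 7 — CONTROL-ONLY)

HONEST FRAMING: lottery ticket; floor = tightest certified 3D Ising CFT bounds; no exact-solution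
claim without a proof. CONTROL-ONLY (`d = 2`); nothing numerical is asserted here.

For `0 < x < 1`:

* `vtxAlpha q n = α_n(q) = Σ_{j<n} q^{j+1}/(j+1)! · e_{j,n}` (`≥ 0` for `q ≥ 0`; `α_1 = q`, `α_2 = q²/2`;
  `α_n(-q) = (-1)^n α_n(q)`), and for EVERY real `q`:
  `hasSum_vtx_rpow` — **`(1-x)^{-q} - 1 = Σ_n α_n(q) k_{2n}(x)`** (`(1-x)^{-q} = exp(q k_2(x))`, the
  exponential series, `k_2^{j+1} = Σ_n e_{j,n} k_{2n}`, Tonelli for `q ≥ 0` and absolute convergence by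
  comparison with `|q|` in general), `hasSum_vtx_rpow_pos` — **`(1-x)^{q} - 1 = Σ_n (-1)^n α_n(q) k_{2n}(x)`**;
* `hasSum_vtx_charge` — **`x^{2q}/(1-x)^q = Σ_k γ_k(q) k_{4q+4k}(x)`** for `q > 0`
  (`γ_k = vtxGamma k q > 0`; coefficients matched by `vtxY_eq_vtxWG`, binomial series, Tonelli).

With `q = s` these are the chiral halves of the three pieces `v^{-s}`, `v^{s}`, `u^{2s} v^{-s}` of the
free-boson vertex four-point function `𝒢 = ½(v^{-s} + v^{s} + u^{2s}v^{-s})` (Di Francesco–Mathieu–Sénéchal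
§9.1), assembled in `Control2DVertexNonVacuity`.

References: Ph. Di Francesco, P. Mathieu, D. Sénéchal, Conformal Field Theory (Springer 1997), §9.1
[cite: DiFrancescoMathieuSenechal1997, §9.1]; F. A. Dolan, H. Osborn, Nucl. Phys. B 678 (2004) 491, §3
[cite: DolanOsborn2004, §3]. Mathlib: `NormedSpace.expSeries_div_hasSum_exp` (used inline; the same shift
exists as `Literature/…/Balaban1983to89/…/hasSum_expSeries_sub_one_real`, not imported here to keep the 2D
closure free of the 4D Yang–Mills chain), `Real.rpow_def_of_pos`,
`summable_prod_of_nonneg`, `HasSum.prod_fiberwise`, `Summable.of_norm_bounded`,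
`Function.Injective.hasSum_iff`. Tree: `hasSum_vtx_pow`, `vtxECoeff` (`Control2DVertexChiral`), `vtxGamma`,
`vtxY_eq_vtxWG` (`Control2DVertexRecursion`), `hasSum_poch_div_factorial_mul_pow`
(`Literature/…/MeanFieldDecomposition`).
-/

namespace Summit.CriticalPhenomena.Ising3D.Control2D

open Finset Set
open Literature.MathematicalPhysics.QuantumFieldTheory.ConformalBootstrap3D

section Expansions

variable {q x : ℝ}

/-! ### `(1-x)^{∓q} = Σ_n (±1)^n α_n(q) k_{2n}(x)` -/

/-- **`α_n(q) = Σ_{j<n} q^{j+1}/(j+1)! · e_{j,n}`**: the coefficient of `k_{2n}(x)` in `(1-x)^{-q}` for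
`n ≥ 1` (`α_1 = q`, `α_2 = q²/2`, `α_3 = q³/6`, `α_4 = q⁴/24 + q²/120`, …; no product closed form).
[folklore] -/
noncomputable def vtxAlpha (q : ℝ) (n : ℕ) : ℝ :=
  ∑ j ∈ range n, q ^ (j + 1) / ((j + 1).factorial : ℝ) * vtxECoeff j n

/-- `α_n(q) ≥ 0` for `q ≥ 0`. [folklore] -/
theorem vtxAlpha_nonneg (hq : 0 ≤ q) (n : ℕ) : 0 ≤ vtxAlpha q n :=
  sum_nonneg fun j _ => mul_nonneg (by positivity) (vtxECoeff_nonneg j n)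

/-- `α_0 = 0` (the identity is kept apart), `α_1(q) = q`, `α_2(q) = q²/2`. [folklore] -/
theorem vtxAlpha_values (q : ℝ) : vtxAlpha q 0 = 0 ∧ vtxAlpha q 1 = q ∧ vtxAlpha q 2 = q ^ 2 / 2 := by
  obtain ⟨h01, h12, h02⟩ := vtxECoeff_values
  refine ⟨by simp [vtxAlpha], ?_, ?_⟩
  · simp [vtxAlpha, h01]
  · rw [vtxAlpha, sum_range_succ, sum_range_one, h02, h12]
    simp

/-- The double family `Φ_q(j, n) = q^{j+1}/(j+1)! · e_{j,n} k_{2n}(x)`. [folklore] -/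
noncomputable def vtxExpDouble (q x : ℝ) (jn : ℕ × ℕ) : ℝ :=
  q ^ (jn.1 + 1) / ((jn.1 + 1).factorial : ℝ) * (vtxECoeff jn.1 jn.2 * chiralBlock jn.2 x)

/-- `(1 - x)^{-q} = exp(q k_2(x))` on `0 < x < 1`. [folklore] -/
theorem rpow_neg_eq_exp_chiralBlock (q : ℝ) (hx : x ∈ Ioo (0 : ℝ) 1) :
    (1 - x) ^ (-q) = Real.exp (q * chiralBlock 1 x) := by
  rw [Real.rpow_def_of_pos (by linarith [hx.2]), chiralBlock_one_eq_neg_log hx]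
  congr 1
  ring

/-- `Φ_q ≥ 0` for `q ≥ 0`. [folklore] -/
theorem vtxExpDouble_nonneg (hq : 0 ≤ q) (hx : x ∈ Ioo (0 : ℝ) 1) (jn : ℕ × ℕ) :
    0 ≤ vtxExpDouble q x jn := by
  unfold vtxExpDouble
  have h1 := vtxECoeff_nonneg jn.1 jn.2
  have h2 := chiralBlock_nonneg (Nat.cast_nonneg jn.2) hx
  positivity

/-- `‖Φ_q(j,n)‖ = Φ_{|q|}(j,n)`. [folklore] -/
theorem norm_vtxExpDouble (q : ℝ) (hx : x ∈ Ioo (0 : ℝ) 1) (jn : ℕ × ℕ) :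
    ‖vtxExpDouble q x jn‖ = vtxExpDouble |q| x jn := by
  unfold vtxExpDouble
  have h1 := vtxECoeff_nonneg jn.1 jn.2
  have h2 := chiralBlock_nonneg (Nat.cast_nonneg jn.2) hx
  rw [Real.norm_eq_abs, abs_mul, abs_div, abs_pow, abs_of_nonneg (mul_nonneg h1 h2),
    abs_of_nonneg (by positivity : (0 : ℝ) ≤ ((jn.1 + 1).factorial : ℝ))]

/-- Rows of `Φ_q`: `Σ_n Φ_q(j, n) = q^{j+1}/(j+1)! · k_2(x)^{j+1}`. [folklore] -/
theorem hasSum_vtxExpDouble_row (q : ℝ) (hx : x ∈ Ioo (0 : ℝ) 1) (j : ℕ) :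
    HasSum (fun n : ℕ => vtxExpDouble q x (j, n))
      (q ^ (j + 1) / ((j + 1).factorial : ℝ) * chiralBlock 1 x ^ (j + 1)) :=
  ((hasSum_vtx_pow hx j).mul_left _).congr_fun fun n => by simp only [vtxExpDouble]

/-- Columns of `Φ_q`: `Σ_j Φ_q(j, n) = α_n(q) k_{2n}(x)` (a finite sum, `e_{j,n} = 0` for `j ≥ n`). [folklore] -/
theorem hasSum_vtxExpDouble_col (q x : ℝ) (n : ℕ) :
    HasSum (fun j : ℕ => vtxExpDouble q x (j, n)) (vtxAlpha q n * chiralBlock n x) := by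
  have hfin : ∀ j ∉ range n, vtxExpDouble q x (j, n) = 0 := by
    intro j hj
    rw [Finset.mem_range] at hj
    simp [vtxExpDouble, vtxECoeff_eq_zero_of_lt j (show n < j + 1 by omega)]
  have hval : ∑ j ∈ range n, vtxExpDouble q x (j, n) = vtxAlpha q n * chiralBlock n x := by
    rw [vtxAlpha, Finset.sum_mul]
    exact sum_congr rfl fun j _ => by simp only [vtxExpDouble]; ring
  rw [← hval]
  exact hasSum_sum_of_ne_finset_zero hfin

/-- The row sums add up to `(1-x)^{-q} - 1 = exp(q k_2(x)) - 1`. [folklore] -/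
theorem hasSum_vtxExp_rows (q : ℝ) (hx : x ∈ Ioo (0 : ℝ) 1) :
    HasSum (fun j : ℕ => q ^ (j + 1) / ((j + 1).factorial : ℝ) * chiralBlock 1 x ^ (j + 1))
      ((1 - x) ^ (-q) - 1) := by
  rw [rpow_neg_eq_exp_chiralBlock q hx]
  -- the exponential series without its constant term (Mathlib's `expSeries_div_hasSum_exp`, shifted by one)
  have hexp : HasSum (fun j : ℕ => (q * chiralBlock 1 x) ^ (j + 1) / ((j + 1).factorial : ℝ))
      (Real.exp (q * chiralBlock 1 x) - 1) := by
    have h : HasSum (fun j : ℕ => (q * chiralBlock 1 x) ^ j / (j.factorial : ℝ)) (Real.exp (q * chiralBlock 1 x)) := by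
      rw [Real.exp_eq_exp_ℝ]
      exact NormedSpace.expSeries_div_hasSum_exp _
    simpa using (hasSum_nat_add_iff' 1).2 h
  refine hexp.congr_fun fun j => ?_
  rw [mul_pow]; ring

/-- `Φ_q` is summable (for `q ≥ 0` by Tonelli; in general by comparison with `Φ_{|q|}`). [folklore] -/
theorem summable_vtxExpDouble (q : ℝ) (hx : x ∈ Ioo (0 : ℝ) 1) : Summable (vtxExpDouble q x) := by
  have hpos : ∀ {r : ℝ}, 0 ≤ r → Summable (vtxExpDouble r x) := fun {r} hr =>
    (summable_prod_of_nonneg (vtxExpDouble_nonneg hr hx)).2 ⟨fun j => (hasSum_vtxExpDouble_row r hx j).summable,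
      (hasSum_vtxExp_rows r hx).summable.congr fun j => ((hasSum_vtxExpDouble_row r hx j).tsum_eq).symm⟩
  exact Summable.of_norm_bounded (hpos (abs_nonneg q)) fun jn => le_of_eq (norm_vtxExpDouble q hx jn)

/-- **`(1-x)^{-q} - 1 = Σ_n α_n(q) k_{2n}(x)`** for every real `q` and `0 < x < 1` (`HasSum`): for
`q = s > 0` the chiral half of the `v^{-s}` piece, for `q = -s` that of the `v^{s}` piece
(exponential of the current block, Tonelli / absolute convergence). [cite: DiFrancescoMathieuSenechal1997, §9.1] -/
theorem hasSum_vtx_rpow (q : ℝ) (hx : x ∈ Ioo (0 : ℝ) 1) :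
    HasSum (fun n : ℕ => vtxAlpha q n * chiralBlock n x) ((1 - x) ^ (-q) - 1) := by
  have h1 := (summable_vtxExpDouble q hx).hasSum
  have hΦ : HasSum (vtxExpDouble q x) ((1 - x) ^ (-q) - 1) := by
    rwa [(h1.prod_fiberwise (hasSum_vtxExpDouble_row q hx)).unique (hasSum_vtxExp_rows q hx)] at h1
  have hΦ' := (Equiv.prodComm ℕ ℕ).hasSum_iff.mpr hΦ
  exact hΦ'.prod_fiberwise fun n => (hasSum_vtxExpDouble_col q x n).congr_fun fun j => rfl

/-- Parity of the current-family coefficients: `α_n(-q) = (-1)^n α_n(q)` (`e_{j,n} ≠ 0` only for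
`n ≡ j + 1 (mod 2)`). [folklore] -/
theorem vtxAlpha_neg (q : ℝ) (n : ℕ) : vtxAlpha (-q) n = (-1 : ℝ) ^ n * vtxAlpha q n := by
  unfold vtxAlpha
  rw [Finset.mul_sum]
  refine sum_congr rfl fun j _ => ?_
  by_cases hpar : (n + j) % 2 = 0
  · rw [vtxECoeff_eq_zero_of_parity j hpar]; ring
  · have hε : (-1 : ℝ) ^ (j + 1) = (-1) ^ n := by
      rcases Nat.even_or_odd n with hn | hn
      · have hj : Even (j + 1) := by
          rw [Nat.even_iff] at hn ⊢; omega
        rw [hj.neg_one_pow, hn.neg_one_pow]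
      · have hj : Odd (j + 1) := by
          rw [Nat.odd_iff] at hn ⊢; omega
        rw [hj.neg_one_pow, hn.neg_one_pow]
    rw [neg_pow q, hε]
    ring

/-- **`(1-x)^{q} - 1 = Σ_n (-1)^n α_n(q) k_{2n}(x)`** for every real `q`, `0 < x < 1`.
[cite: DiFrancescoMathieuSenechal1997, §9.1] -/
theorem hasSum_vtx_rpow_pos (q : ℝ) (hx : x ∈ Ioo (0 : ℝ) 1) :
    HasSum (fun n : ℕ => (-1 : ℝ) ^ n * (vtxAlpha q n * chiralBlock n x)) ((1 - x) ^ q - 1) := by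
  have h := hasSum_vtx_rpow (-q) hx
  rw [neg_neg] at h
  refine h.congr_fun fun n => ?_
  rw [vtxAlpha_neg]; ring

/-! ### The charge-two family `x^{2q}/(1-x)^q = Σ_k γ_k(q) k_{4q+4k}(x)` -/

/-- The double family `F(k, n) = γ_k(q) κ_{2q+2k}(n) x^{(2q+2k)+n} ≥ 0`. [folklore] -/
noncomputable def vtxChargeDouble (q x : ℝ) (kn : ℕ × ℕ) : ℝ :=
  vtxGamma kn.1 q * (chiralCoeff (2 * q + 2 * kn.1) kn.2 * x ^ (2 * q + 2 * (kn.1 : ℝ) + (kn.2 : ℝ)))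

/-- Re-indexed by total degree: `G(m, k) = [2k ≤ m] F(k, m - 2k)`. [folklore] -/
noncomputable def vtxChargeDiag (q x : ℝ) (mk : ℕ × ℕ) : ℝ :=
  if 2 * mk.2 ≤ mk.1 then vtxChargeDouble q x (mk.2, mk.1 - 2 * mk.2) else 0

/-- The re-indexing map `(k, n) ↦ (n + 2k, k)` is injective. [folklore] -/
theorem vtxChargeReindex_injective :
    Function.Injective (fun kn : ℕ × ℕ => (kn.2 + 2 * kn.1, kn.1)) := by
  intro p p' h
  simp only [Prod.mk.injEq] at h
  obtain ⟨h1, h2⟩ := h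
  exact Prod.ext h2 (by omega)

/-- **`x^{2q}/(1-x)^q = Σ_k γ_k(q) k_{4q+4k}(x)`** for `q > 0`, `0 < x < 1` (`HasSum`, all terms positive):
the chiral half of the `u^{2s} v^{-s}` piece. The function-level form of `vtxY_eq_vtxWG`.
[cite: DiFrancescoMathieuSenechal1997, §9.1] -/
theorem hasSum_vtx_charge (hq : 0 < q) (hx : x ∈ Ioo (0 : ℝ) 1) :
    HasSum (fun k : ℕ => vtxGamma k q * chiralBlock (2 * q + 2 * k) x) (x ^ (2 * q) / (1 - x) ^ q) := by
  have hbin := hasSum_poch_div_factorial_mul_pow q (x := x) (by rw [abs_of_pos hx.1]; exact hx.2)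
  have hY : HasSum (fun m : ℕ => vtxY q m * x ^ (2 * q + (m : ℝ))) (x ^ (2 * q) / (1 - x) ^ q) := by
    have h := hbin.mul_left (x ^ (2 * q))
    rw [show x ^ (2 * q) * (1 / (1 - x) ^ q) = x ^ (2 * q) / (1 - x) ^ q by ring] at h
    refine h.congr_fun fun m => ?_
    rw [vtxY, Real.rpow_add hx.1, Real.rpow_natCast]
    ring
  have hF0 : ∀ kn, 0 ≤ vtxChargeDouble q x kn := fun kn => by
    unfold vtxChargeDouble
    have h1 := (vtxGamma_pos kn.1 hq).le
    have h2 := chiralCoeff_nonneg (show (0 : ℝ) ≤ 2 * q + 2 * kn.1 by positivity) kn.2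
    have h3 : 0 ≤ x ^ (2 * q + 2 * (kn.1 : ℝ) + (kn.2 : ℝ)) := Real.rpow_nonneg hx.1.le _
    positivity
  have hrows : ∀ m : ℕ, HasSum (fun k : ℕ => vtxChargeDiag q x (m, k)) (vtxWG q m * x ^ (2 * q + (m : ℝ))) := by
    intro m
    have hfin : ∀ k ∉ range (m + 1), vtxChargeDiag q x (m, k) = 0 := by
      intro k hk
      rw [Finset.mem_range] at hk
      simp [vtxChargeDiag, show ¬ 2 * k ≤ m by omega]
    have hval : ∑ k ∈ range (m + 1), vtxChargeDiag q x (m, k) = vtxWG q m * x ^ (2 * q + (m : ℝ)) := by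
      rw [vtxWG, Finset.sum_mul]
      refine sum_congr rfl fun k _ => ?_
      by_cases h : 2 * k ≤ m
      · simp only [vtxChargeDiag, if_pos h, vtxChargeDouble]
        rw [Nat.cast_sub h]
        push_cast
        rw [show 2 * q + 2 * (k : ℝ) + ((m : ℝ) - 2 * k) = 2 * q + m by ring]
        ring
      · simp only [vtxChargeDiag, if_neg h, zero_mul]
    rw [← hval]
    exact hasSum_sum_of_ne_finset_zero hfin
  have hGs : Summable (vtxChargeDiag q x) := by
    refine (summable_prod_of_nonneg fun mk => ?_).2 ⟨fun m => (hrows m).summable, ?_⟩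
    · unfold vtxChargeDiag
      split_ifs
      · exact hF0 _
      · exact le_rfl
    · refine hY.summable.congr fun m => ?_
      rw [(hrows m).tsum_eq, vtxY_eq_vtxWG m hq]
  have hG : HasSum (vtxChargeDiag q x) (x ^ (2 * q) / (1 - x) ^ q) := by
    have h1 := hGs.hasSum
    have h3 : HasSum (fun m : ℕ => vtxWG q m * x ^ (2 * q + (m : ℝ))) (x ^ (2 * q) / (1 - x) ^ q) :=
      hY.congr_fun fun m => by rw [vtxY_eq_vtxWG m hq]
    rwa [(h1.prod_fiberwise hrows).unique h3] at h1
  have hcomp : vtxChargeDiag q x ∘ (fun kn : ℕ × ℕ => (kn.2 + 2 * kn.1, kn.1)) = vtxChargeDouble q x := by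
    funext p
    simp only [Function.comp_apply, vtxChargeDiag]
    rw [if_pos (by omega), show p.2 + 2 * p.1 - 2 * p.1 = p.2 by omega]
  have hzero : ∀ mk, mk ∉ Set.range (fun kn : ℕ × ℕ => (kn.2 + 2 * kn.1, kn.1)) →
      vtxChargeDiag q x mk = 0 := by
    intro mk hmk
    unfold vtxChargeDiag
    split_ifs with hle
    · exfalso; apply hmk
      exact ⟨(mk.2, mk.1 - 2 * mk.2), Prod.ext (by simp; omega) (by simp)⟩
    · rfl
  have hF : HasSum (vtxChargeDouble q x) (x ^ (2 * q) / (1 - x) ^ q) := by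
    rw [← hcomp]
    exact (vtxChargeReindex_injective.hasSum_iff hzero).2 hG
  refine hF.prod_fiberwise fun k => ?_
  have h := (hasSum_chiralBlock (2 * q + 2 * k) hx.1 hx.2).mul_left (vtxGamma k q)
  exact h.congr_fun fun n => by simp only [vtxChargeDouble]

end Expansions

end Summit.CriticalPhenomena.Ising3D.Control2D
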